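import Summits.QuantumFields.YangMills.Theorems.UnitScaleTiltProp7SectET3CoordJunction
import HarnessLib

/-!
# Route `UnitScaleTilt` (α), node N06(d = 3), layer 0 ∕ brick L0f — **THE ALGEBRAIC ROWS OF A LETTER RECORD `B9Thm312Whole.Ops` THAT IS THE COORDINATE-CONJUGATE READING OF
# HILBERT-LEVEL LETTERS**: `Identities 𝔬 U` (all thirteen fields), the four letter symmetries of ✓ `Prop7SectET3OpsSymmetry` (`S0`, `Tpi`, `T2` symmetric; (`D`, `Dstar`) a transpose
# pair) and the positivity `PosDefEnd (𝔬.S0 U)` of `FormSmall.posS0`, FROM the corresponding identities ∕ adjointness ∕ symmetry ∕ positivity of the Hilbert letters — generic, def-free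

Cell `ym-inputs` (D-0154 (2); desk `ym-inputs-plan-1` INPUT-LIST v6 §4 row p05 = I-06 (d); ym-inputs-p01's DEFINER-MEMO-T3.md brick L0f «`𝔬_T3` = ℝ-coordinates of the layer-0
letters»; the seat's design point (J1), bus 2026-08-28 ≈09:15Z), seat ym-inputs-p05.  Count-neutral helper (`--supports stmt-QuantumFields-20520 --as helper`; RULING g26-№2); registry
untouched; THEOREMS ONLY (0 `def`, 0 `sorry`); NOTHING of [Balaban1985BackgroundPropagators] is asserted.

THE POINT.  Layer 0 (ym-inputs-p01: ✓ `…SectET3HilbertLettersT3`, ✓ `…SectET3GaugeProjectorT3`, ✓ `…SectET3CurvedPropagatorsT3`, L0b∕L0e pending) constructs print's letters as linear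
maps between (weighted L²) spaces of M₂(ℂ)-valued lattice fields and proves their identities ((3.122), (3.126), (3.129), (3.147)∕(3.153), (3.124), `RD*G₁DR = R`), adjointness (p. 391)
and positivity (Thm 3.11, on the class `PosOnto`) THERE.  Brick L0f reads them on Track A's ℝ-model `Ops (geo9K i) (bgT3 i) X Y Z W` by CONJUGATION with coordinate equivalences
`e_X : M_X ≃ₗ[ℝ] (X → ℝ)`, … that turn the model pairings into component sums (✓ `Prop7SectET3CoordJunction`).  THIS FILE is the transfer, once and for all: given ANY `𝔬 : Ops g B X Y Z W`
whose sixteen relevant letters at `U` ARE such conjugates (hypotheses `rG0 … rR`, each an `rfl` for an instance so defined), the Hilbert-level identities give `Identities 𝔬 U` VERBATIM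
(★★★ `identities_of_conjugateReading`), the Hilbert-level symmetries∕adjointness give the letter-symmetry row of `normG_row_of_evaluationRows` ∕ `normH₁_row_of_evaluationRows`
(★★ `letterSymm_of_conjugateReading`), and Hilbert-level positivity of `Δ_a` gives `PosDefEnd (𝔬.S0 U)` (★ `posDefEnd_S0_of_conjugateReading`).  So `…SectET3OpsT3Rows.lean` (L0f's
def-free sibling) is: sixteen `rfl`s + p01's L0e rows, by `exact`.

WHAT IS PROVED (ns `…Theorems.Prop7SectET3OpsOfConjugateReading`): §1 conjugation bookkeeping for `+`, `−` (`conj_add`, `conj_sub`; `∘`, `id`, `0`, injectivity are ✓ `Prop7SectET3CoordJunction`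
§4); §2 ★★★ `identities_of_conjugateReading`; §3 ★★ `letterSymm_of_conjugateReading`, ★ `posDefEnd_S0_of_conjugateReading`.
HONEST SCOPE: linear algebra ([folklore]); no letter is DEFINED here (layer 0's definitions lane), no identity of print is asserted (they are hypotheses at the Hilbert level, = L0e's
theorems on the class `PosOnto`); N06(d = 3) NOT discharged; nothing here claims EX, the crux, d = 4 or the mass gap; YM₃ on T³ is ladder rung R3, not the Clay problem.

References: T. Bałaban, CMP **99** (1985) 389–434 [Balaban1985BackgroundPropagators] (p.391; (3.120)–(3.130) pp.419–421; (3.124) p.420; (3.147) p.425; (3.152)–(3.153) p.426;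
Thm 3.11 p.416).
-/

set_option autoImplicit false

namespace Summit.QuantumFields.YangMills.Theorems.Prop7SectET3OpsOfConjugateReading

open Literature.MathematicalPhysics.QuantumFieldTheory.Balaban1983to89
open Literature.MathematicalPhysics.QuantumFieldTheory.Balaban1983to89.B9Thm37Glue (IsTransposePair)
open Literature.MathematicalPhysics.QuantumFieldTheory.Balaban1983to89.B9Thm312Whole (Ops frakPstar PosDefEnd Identities)
open Summit.QuantumFields.YangMills.Theorems.Prop7SectET3CoordJunction (isTransposePair_conj_iff posDefEnd_conj_iff conj_comp_conj conj_id conj_inj_iff conj_eq_zero_iff)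

/-! ## §1 Conjugation bookkeeping for sums and differences -/

section Conj

variable {M₁ M₂ : Type} [AddCommGroup M₁] [Module ℝ M₁] [AddCommGroup M₂] [Module ℝ M₂] {X Y : Type}

/-- Conjugation is additive: `e₂ (A + B) e₁⁻¹ = e₂ A e₁⁻¹ + e₂ B e₁⁻¹`. [folklore] -/
theorem conj_add (e₁ : M₁ ≃ₗ[ℝ] (X → ℝ)) (e₂ : M₂ ≃ₗ[ℝ] (Y → ℝ)) (A B : M₁ →ₗ[ℝ] M₂) :
    e₂.toLinearMap ∘ₗ (A + B) ∘ₗ e₁.symm.toLinearMap = e₂.toLinearMap ∘ₗ A ∘ₗ e₁.symm.toLinearMap + e₂.toLinearMap ∘ₗ B ∘ₗ e₁.symm.toLinearMap := by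
  rw [LinearMap.add_comp, LinearMap.comp_add]

/-- Conjugation respects differences: `e₂ (A − B) e₁⁻¹ = e₂ A e₁⁻¹ − e₂ B e₁⁻¹`. [folklore] -/
theorem conj_sub (e₁ : M₁ ≃ₗ[ℝ] (X → ℝ)) (e₂ : M₂ ≃ₗ[ℝ] (Y → ℝ)) (A B : M₁ →ₗ[ℝ] M₂) :
    e₂.toLinearMap ∘ₗ (A - B) ∘ₗ e₁.symm.toLinearMap = e₂.toLinearMap ∘ₗ A ∘ₗ e₁.symm.toLinearMap - e₂.toLinearMap ∘ₗ B ∘ₗ e₁.symm.toLinearMap := by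
  rw [LinearMap.sub_comp, LinearMap.comp_sub]

end Conj

/-! ## §2 `Identities 𝔬 U` from the Hilbert-level identities under a conjugate reading -/

section Ident

variable {g : B9.Geometry} {B : B9.Backgrounds} {X Y Z W : Type} [Fintype X] [Fintype Z] [Fintype W]
variable {MX MZ MW : Type} [AddCommGroup MX] [Module ℝ MX] [AddCommGroup MZ] [Module ℝ MZ] [AddCommGroup MW] [Module ℝ MW]

/-- ★★★ **`Identities 𝔬 U` FROM THE HILBERT LETTERS.**  Data: coordinate equivalences `eX`, `eZ`, `eW` for the bond-, block- and scalar-site-lattices turning the model pairings `PX`, `PZ`,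
`PW` into component sums; Hilbert-level letters `g0 s0 tpi t2 g g1 gg` (G₀, Δ_a, Δ′_π, Δ⁽²⁾_π, G, G₁, 𝔊), `q qstar c c1 hm h1m` (Q, Q*, (QGQ*)⁻¹, (QG₁Q*)⁻¹, H, H₁), `dv dvstar r` (D, D*, R of
DRD*); READING hypotheses: the sixteen corresponding fields of `𝔬` at `U` ARE the conjugates (`rfl` for an instance so defined); HILBERT-LEVEL hypotheses: `G₀Δ_a = 1`, `(Δ_a − Δ′_π)G = 1`,
`(Δ_a − Δ′_π − Δ⁽²⁾_π)G₁ = 1`, (3.126), (3.129), (3.153) with 𝔓* spelled out, `(QG₁Q*)(QG₁Q*)⁻¹ = 1`, (3.124) `QG₁DR = 0`, `RD*G₁Q* = 0`, `RD*G₁DR = R`, and the adjointness ∕ symmetry `PZ (Q u) b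
= PX u (Q* b)`, `PX (D s) f = PW s (D* f)`, `PW (R s) t = PW s (R t)`.  Conclusion: `Identities 𝔬 U` — all thirteen fields, verbatim the schema of the leaves' `hmodel`.
[cite: Balaban1985BackgroundPropagators, (3.120)–(3.130) pp.419–421, (3.124) p.420, (3.147) p.425, (3.152)–(3.153) p.426, p.391] -/
theorem identities_of_conjugateReading (𝔬 : Ops g B X Y Z W) (U : B.Cfg)
    (eX : MX ≃ₗ[ℝ] (X → ℝ)) (eZ : MZ ≃ₗ[ℝ] (Z → ℝ)) (eW : MW ≃ₗ[ℝ] (W → ℝ)) (PX : MX → MX → ℝ) (PZ : MZ → MZ → ℝ) (PW : MW → MW → ℝ)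
    (hPX : ∀ u v, ∑ x, eX u x * eX v x = PX u v) (hPZ : ∀ u v, ∑ z, eZ u z * eZ v z = PZ u v) (hPW : ∀ u v, ∑ w, eW u w * eW v w = PW u v)
    (g0 s0 tpi t2 g g1 gg : MX →ₗ[ℝ] MX) (q : MX →ₗ[ℝ] MZ) (qstar : MZ →ₗ[ℝ] MX) (c c1 : MZ →ₗ[ℝ] MZ) (hm h1m : MZ →ₗ[ℝ] MX)
    (dv : MW →ₗ[ℝ] MX) (dvstar : MX →ₗ[ℝ] MW) (r : MW →ₗ[ℝ] MW)
    -- ======== the conjugate reading ========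
    (rG0 : 𝔬.G0 U = eX.toLinearMap ∘ₗ g0 ∘ₗ eX.symm.toLinearMap) (rS0 : 𝔬.S0 U = eX.toLinearMap ∘ₗ s0 ∘ₗ eX.symm.toLinearMap)
    (rTpi : 𝔬.Tpi U = eX.toLinearMap ∘ₗ tpi ∘ₗ eX.symm.toLinearMap) (rT2 : 𝔬.T2 U = eX.toLinearMap ∘ₗ t2 ∘ₗ eX.symm.toLinearMap)
    (rG : 𝔬.G U = eX.toLinearMap ∘ₗ g ∘ₗ eX.symm.toLinearMap) (rG1 : 𝔬.G1 U = eX.toLinearMap ∘ₗ g1 ∘ₗ eX.symm.toLinearMap)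
    (rGG : 𝔬.GG U = eX.toLinearMap ∘ₗ gg ∘ₗ eX.symm.toLinearMap)
    (rQ : 𝔬.Q U = eZ.toLinearMap ∘ₗ q ∘ₗ eX.symm.toLinearMap) (rQstar : 𝔬.Qstar U = eX.toLinearMap ∘ₗ qstar ∘ₗ eZ.symm.toLinearMap)
    (rC : 𝔬.C U = eZ.toLinearMap ∘ₗ c ∘ₗ eZ.symm.toLinearMap) (rC1 : 𝔬.C1 U = eZ.toLinearMap ∘ₗ c1 ∘ₗ eZ.symm.toLinearMap)
    (rHm : 𝔬.Hm U = eX.toLinearMap ∘ₗ hm ∘ₗ eZ.symm.toLinearMap) (rH1m : 𝔬.H1m U = eX.toLinearMap ∘ₗ h1m ∘ₗ eZ.symm.toLinearMap)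
    (rDv : 𝔬.Dv U = eX.toLinearMap ∘ₗ dv ∘ₗ eW.symm.toLinearMap) (rDvstar : 𝔬.Dvstar U = eW.toLinearMap ∘ₗ dvstar ∘ₗ eX.symm.toLinearMap)
    (rR : 𝔬.R U = eW.toLinearMap ∘ₗ r ∘ₗ eW.symm.toLinearMap)
    -- ======== the Hilbert-level identities ========
    (invG0' : g0 ∘ₗ s0 = LinearMap.id) (invG : (s0 - tpi) ∘ₗ g = LinearMap.id) (invG1 : (s0 - (tpi + t2)) ∘ₗ g1 = LinearMap.id)
    (eq126 : hm = g ∘ₗ qstar ∘ₗ c) (eq129 : h1m = g1 ∘ₗ qstar ∘ₗ c1)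
    (eq153 : gg = g1 ∘ₗ (LinearMap.id - qstar ∘ₗ c1 ∘ₗ q ∘ₗ g1 - dv ∘ₗ r ∘ₗ dvstar ∘ₗ g1))
    (c1_inv : q ∘ₗ g1 ∘ₗ qstar ∘ₗ c1 = LinearMap.id) (h124Q : q ∘ₗ g1 ∘ₗ dv ∘ₗ r = 0) (h124R : r ∘ₗ dvstar ∘ₗ g1 ∘ₗ qstar = 0)
    (hR : r ∘ₗ dvstar ∘ₗ g1 ∘ₗ dv ∘ₗ r = r)
    (adjQ : ∀ (u : MX) (b : MZ), PZ (q u) b = PX u (qstar b)) (adjDv : ∀ (s : MW) (f : MX), PX (dv s) f = PW s (dvstar f))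
    (symmR : ∀ s t : MW, PW (r s) t = PW s (r t)) :
    Identities 𝔬 U where
  invG0' := by
    rw [rG0, rS0, Module.End.mul_eq_comp, conj_comp_conj, invG0', conj_id]; rfl
  invG := by
    rw [rS0, rTpi, rG, ← conj_sub, Module.End.mul_eq_comp, conj_comp_conj, invG, conj_id]; rfl
  invG1 := by
    rw [rS0, rTpi, rT2, rG1, ← conj_add, ← conj_sub, Module.End.mul_eq_comp, conj_comp_conj, invG1, conj_id]; rfl
  eq126 := by rw [rHm, rG, rQstar, rC, conj_comp_conj, conj_comp_conj, eq126]
  eq129 := by rw [rH1m, rG1, rQstar, rC1, conj_comp_conj, conj_comp_conj, eq129]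
  eq153 := by
    have hP : frakPstar 𝔬 U = eX.toLinearMap ∘ₗ (LinearMap.id - qstar ∘ₗ c1 ∘ₗ q ∘ₗ g1 - dv ∘ₗ r ∘ₗ dvstar ∘ₗ g1) ∘ₗ eX.symm.toLinearMap := by
      unfold frakPstar
      rw [rQstar, rC1, rQ, rG1, rDv, rR, rDvstar, conj_comp_conj, conj_comp_conj, conj_comp_conj, conj_comp_conj, conj_comp_conj, conj_comp_conj,
        conj_sub, conj_sub, conj_id]
    rw [rGG, hP, rG1, conj_comp_conj, eq153]
  c1_inv := by rw [rQ, rG1, rQstar, rC1, conj_comp_conj, conj_comp_conj, conj_comp_conj, c1_inv, conj_id]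
  h124Q := by rw [rQ, rG1, rDv, rR, conj_comp_conj, conj_comp_conj, conj_comp_conj, h124Q, conj_eq_zero_iff]
  h124R := by rw [rR, rDvstar, rG1, rQstar, conj_comp_conj, conj_comp_conj, conj_comp_conj, h124R, conj_eq_zero_iff]
  hR := by rw [rR, rDvstar, rG1, rDv, conj_comp_conj, conj_comp_conj, conj_comp_conj, conj_comp_conj, hR]
  adjQ := by
    rw [rQ, rQstar]
    exact fun f b => (isTransposePair_conj_iff eX eZ PX PZ hPX hPZ q qstar).2 adjQ f b
  adjDv := by
    rw [rDv, rDvstar]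
    exact fun s f => (isTransposePair_conj_iff eW eX PW PX hPW hPX dv dvstar).2 adjDv s f
  symmR := by
    rw [rR]
    exact fun s t => (isTransposePair_conj_iff eW eW PW PW hPW hPW r r).2 symmR s t

end Ident

/-! ## §3 The letter-symmetry row and the positivity of `Δ_a` under a conjugate reading -/

section Symm

variable {g : B9.Geometry} {B : B9.Backgrounds} {X Y Z W : Type} [Fintype X] [Fintype Y]
variable {MX MY : Type} [AddCommGroup MX] [Module ℝ MX] [AddCommGroup MY] [Module ℝ MY]

/-- ★★ **THE FOUR LETTER SYMMETRIES FROM THE HILBERT LETTERS**: if `S0`, `Tpi`, `T2`, `D`, `Dstar` at `U` are the conjugates of `s0`, `tpi`, `t2` (symmetric for `PX`) and of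
(`d`, `dstar`) (an adjoint pair for `PX`, `PY`), then `IsTransposePair (𝔬.S0 U) (𝔬.S0 U) ∧ IsTransposePair (𝔬.Tpi U) (𝔬.Tpi U) ∧ IsTransposePair (𝔬.T2 U) (𝔬.T2 U) ∧ IsTransposePair
(𝔬.D U) (𝔬.Dstar U)` — verbatim the body of the rows `hls`∕`hlsym` of ✓ `normG_row_of_evaluationRows` ∕ ✓ `normH₁_row_of_evaluationRows`. [cite: Balaban1985BackgroundPropagators, p.391, (3.3)∕(3.8) pp.391–392] -/
theorem letterSymm_of_conjugateReading (𝔬 : Ops g B X Y Z W) (U : B.Cfg)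
    (eX : MX ≃ₗ[ℝ] (X → ℝ)) (eY : MY ≃ₗ[ℝ] (Y → ℝ)) (PX : MX → MX → ℝ) (PY : MY → MY → ℝ)
    (hPX : ∀ u v, ∑ x, eX u x * eX v x = PX u v) (hPY : ∀ u v, ∑ y, eY u y * eY v y = PY u v)
    (s0 tpi t2 : MX →ₗ[ℝ] MX) (d : MX →ₗ[ℝ] MY) (dstar : MY →ₗ[ℝ] MX)
    (rS0 : 𝔬.S0 U = eX.toLinearMap ∘ₗ s0 ∘ₗ eX.symm.toLinearMap) (rTpi : 𝔬.Tpi U = eX.toLinearMap ∘ₗ tpi ∘ₗ eX.symm.toLinearMap)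
    (rT2 : 𝔬.T2 U = eX.toLinearMap ∘ₗ t2 ∘ₗ eX.symm.toLinearMap)
    (rD : 𝔬.D U = eY.toLinearMap ∘ₗ d ∘ₗ eX.symm.toLinearMap) (rDstar : 𝔬.Dstar U = eX.toLinearMap ∘ₗ dstar ∘ₗ eY.symm.toLinearMap)
    (hs0 : ∀ u v, PX (s0 u) v = PX u (s0 v)) (htpi : ∀ u v, PX (tpi u) v = PX u (tpi v)) (ht2 : ∀ u v, PX (t2 u) v = PX u (t2 v))
    (hd : ∀ (u : MX) (w : MY), PY (d u) w = PX u (dstar w)) :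
    IsTransposePair (𝔬.S0 U) (𝔬.S0 U) ∧ IsTransposePair (𝔬.Tpi U) (𝔬.Tpi U) ∧ IsTransposePair (𝔬.T2 U) (𝔬.T2 U) ∧ IsTransposePair (𝔬.D U) (𝔬.Dstar U) := by
  rw [rS0, rTpi, rT2, rD, rDstar]
  exact ⟨(isTransposePair_conj_iff eX eX PX PX hPX hPX s0 s0).2 hs0, (isTransposePair_conj_iff eX eX PX PX hPX hPX tpi tpi).2 htpi,
    (isTransposePair_conj_iff eX eX PX PX hPX hPX t2 t2).2 ht2, (isTransposePair_conj_iff eX eY PX PY hPX hPY d dstar).2 hd⟩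

omit [Fintype Y] in
/-- ★ **POSITIVITY OF `Δ_a` (`FormSmall.posS0`, Theorem 3.11's meaning)** under a conjugate reading: `PosDefEnd (𝔬.S0 U)` iff `PX u (s0 u) > 0` for `u ≠ 0`; recorded in the useful
direction. [cite: Balaban1985BackgroundPropagators, Thm 3.11 p.416] -/
theorem posDefEnd_S0_of_conjugateReading (𝔬 : Ops g B X Y Z W) (U : B.Cfg) (eX : MX ≃ₗ[ℝ] (X → ℝ)) (PX : MX → MX → ℝ)
    (hPX : ∀ u v, ∑ x, eX u x * eX v x = PX u v) (s0 : MX →ₗ[ℝ] MX) (rS0 : 𝔬.S0 U = eX.toLinearMap ∘ₗ s0 ∘ₗ eX.symm.toLinearMap)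
    (hpos : ∀ u : MX, u ≠ 0 → 0 < PX u (s0 u)) : PosDefEnd (𝔬.S0 U) := by
  rw [rS0]
  exact (posDefEnd_conj_iff eX PX hPX s0).2 hpos

end Symm

end Summit.QuantumFields.YangMills.Theorems.Prop7SectET3OpsOfConjugateReading
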